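import Summits.QuantumFields.BalabanUV.Beta.FP.KernelReflectionBoundedContact
import Summits.QuantumFields.BalabanUV.Beta.D1BFx.ReducedKernelSandwichLeg
import Summits.QuantumFields.BalabanUV.Beta.VertexReflectionContact

/-!
# `BalabanUV.Beta.FP.FineHessianLegSplit` — road «FP» for binder row D1, ROW KER-γ (α2) sub-row α2-b PART 1 (owner memo `KER-GAMMA-ALPHA2.md` §3 (G1)(G2),
# R-FP-34∕35): ADDITIVITY OF THE ONE-LOOP WORDS IN A BOUNDED LEG — `tadpole (A + B) W = tadpole A W + tadpole B W`,
# `bubble (A + B) V W = bubble A V W + [A,B] + [B,A] + bubble B V W` for BOUNDED legs `A`, `B` (power-law allowed) and BI-LOCALISED vertices, hence the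
# LEG SPLIT of the fine Hessian table: `fineHessA (P + R) S Wf − fineHessA P S Wf` = the displayed R-WORDS (one tadpole, three bubble words)

HONEST DEPENDENCY (page 1, mandatory): continuum YM on T⁴ ⇐ BetaPertH ∧ nine spine estimates (0/9 proved); BetaPertH ⇐ (D1) ∧ (D4) ∧ CAP+tail;
G-an2-4 gates asym, D1 and NE2/3/4.  HONEST FRAMING (cell contract, verbatim): «discharging `BetaPertH` makes Bałaban's UV stability UNCONDITIONAL —
a real constructive-QFT result; it is NOT the continuum limit and NOT the Clay problem.»  THIS MODULE DISCHARGES NOTHING of the wall: it is [folklore]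
kernel bookkeeping (Fubini for `Bdd × BiLoc` slices) BY NAME over gan24-leaf-02-g39's `KernelWardBoundedBricks` (`bdd_of_rl`, `slices_rl_bdd`, `summable_trTerm_rl`),
leaf-02-g9's `KernelReflectionBoundedContact` (`comp_add_right_of_slices`, `tr_add_of_summable`), an3's `VertexReflectionContact.comp_add_left`, leaf-04's `D1BFx/ContactCount` (`abs_comp_le_of_entryBound`,
`abs_comp_le_of_rightLoc`) and `KernelWard.slices_bdd_biLoc`.  It is the `Bdd`-leg twin of road BF-x's `PackedKernelSplit.hessKer_add_leg` (which needs SPREAD legs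
and so excludes the perfect propagator `Pker ∼ ‖z‖⁻²`).  No `def`, no `def … : Prop`, nothing cited, 0 sorry; 0∕4 row-D1 binders; NOT (α2), NOT hsplit,
NOT D1, NOT BetaPertH, NOT continuum, NOT Clay.  «not in print; our bookkeeping».

ABSOLUTE RULE (cell charter, verbatim): «No internally-minted statement may enter as a cited fact. Every hypothesis is either kernel-proved in this package or a
verbatim quotation of a PUBLISHED theorem with page reference. The manuscript(s) under audit are NOT citable for their own disputed steps — they are the thing
under adjudication; programme-internal (2001/route/tribunal) claims are never citable.»

WHY.  In the near piece of the junction (`FineSplitJunctionNearFar`) the gluon table sits on the (1.47)-slice leg `Γ` while the comparison kernel `PiBF`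
sits on `Pker` (`FineHessianTransportTable.PiBF_eq_fineHessA`); writing `Γ = Pker + R` (GAMMA-5 (R1)) the difference of the two gluon tables is the sum of
the words containing at least one `R` — (G1) the three bubble R-words, (G2) the tadpole R-word — provided the words are additive in a merely BOUNDED leg.

WHAT ([folklore]; any `D`, finite fibre).  §1 `rl_add` (right-localised bounds add); §2 **`tadpole_add_leg_bdd`**, **`bubble_add_leg_bdd`**
(the four words `tr((A∘V)∘(A∘W)) + tr((A∘V)∘(B∘W)) + tr((B∘V)∘(A∘W)) + tr((B∘V)∘(B∘W))`); §3 (`D = 4`) **`fineHessA_add_leg_bdd`**: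
`fineHessA (A + B) S Wf κ′ l′ u u′ = fineHessA A S Wf κ′ l′ u u′ + ( ½·tadpole B (Wf κ′ u l′ u′) − ½·( tr((A∘S_{κ′u})∘(B∘S_{l′u′})) + tr((B∘S_{κ′u})∘(A∘S_{l′u′})) + bubble B (S κ′ u) (S l′ u′) ) )`.
Provenance: road FP OWNER b2b-balaban-beta-d1-p3 gen 9 (prover-b2b-balaban-beta-d1-p3-g9-0), 2026-08-21, sub-row α2-b part 1.
-/

noncomputable section

namespace Summit.QuantumFields.BalabanUV.Beta.FP.FineHessianLegSplit

open Finset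
open scoped BigOperators
open Literature.MathematicalPhysics.QuantumFieldTheory.Balaban1983to89
open Literature.MathematicalPhysics.QuantumFieldTheory.Balaban1983to89.Beta
open B12Sec2to5 (l1 l1_nonneg)
open ExpKernelCalculus (Site MKer BiLoc comp tr bubble tadpole)
open KernelWard (Bdd slices_bdd_biLoc)
open Summit.QuantumFields.BalabanUV.Beta.D1BFx.ContactCount (abs_comp_le_of_entryBound abs_comp_le_of_rightLoc)
open Summit.QuantumFields.BalabanUV.Beta.FP.KernelWardBoundedBricks (bdd_of_rl slices_rl_bdd summable_trTerm_rl)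
open Summit.QuantumFields.BalabanUV.Beta.FP.KernelReflectionBoundedContact (comp_add_right_of_slices tr_add_of_summable)
open Summit.QuantumFields.BalabanUV.Beta.VertexReflectionContact (comp_add_left)
open Summit.QuantumFields.BalabanUV.Beta.D1BFx.DressedTablesLeg (tadpoleTableA bubbleTableA tadpoleTableA_apply bubbleTableA_apply)
open Summit.QuantumFields.BalabanUV.Beta.D1BFx.ReducedKernelSandwichLeg (fineHessA fineHessA_apply)

variable {D : ℕ} {F : Type*} [Fintype F]

/-! ## §1 Slices -/

omit [Fintype F] in
/-- [folklore] right-localised bounds add: `|(P + Q) x y a b| ≤ (Kp + Kq)·e^{−δ|y−q|₁}`. -/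
theorem rl_add {P Q : MKer D F} {Kp Kq δ : ℝ} {q : Fin D → ℤ} (hP : ∀ x y a b, |P x y a b| ≤ Kp * Real.exp (-δ * l1 (y - q)))
    (hQ : ∀ x y a b, |Q x y a b| ≤ Kq * Real.exp (-δ * l1 (y - q))) :
    ∀ x y a b, |(P + Q) x y a b| ≤ (Kp + Kq) * Real.exp (-δ * l1 (y - q)) := by
  intro x y a b
  show |P x y a b + Q x y a b| ≤ _
  calc |P x y a b + Q x y a b| ≤ |P x y a b| + |Q x y a b| := abs_add_le _ _
    _ ≤ Kp * Real.exp (-δ * l1 (y - q)) + Kq * Real.exp (-δ * l1 (y - q)) := add_le_add (hP x y a b) (hQ x y a b)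
    _ = (Kp + Kq) * Real.exp (-δ * l1 (y - q)) := by ring

/-! ## §2 Additivity of the one-loop words in a bounded leg -/

/-- [folklore] **THE TADPOLE IS ADDITIVE IN A BOUNDED LEG**: `tadpole (A + B) W = tadpole A W + tadpole B W` for bounded `A`, `B` and a bi-localised table `W`. -/
theorem tadpole_add_leg_bdd {A B W : MKer D F} {CA CB Cw δ : ℝ} {p q : Fin D → ℤ} (hA : Bdd A CA) (hB : Bdd B CB)
    (hW : BiLoc W p q Cw δ) (hδ : 0 < δ) : tadpole (A + B) W = tadpole A W + tadpole B W := by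
  classical
  rcases isEmpty_or_nonempty F with hF | ⟨⟨a₀⟩⟩
  · simp [ExpKernelCalculus.tadpole, ExpKernelCalculus.tr]
  have hCA : 0 ≤ CA := (abs_nonneg _).trans (hA p p a₀ a₀)
  have hCB : 0 ≤ CB := (abs_nonneg _).trans (hB p p a₀ a₀)
  unfold ExpKernelCalculus.tadpole
  rw [comp_add_left (slices_bdd_biLoc hA hW hδ) (slices_bdd_biLoc hB hW hδ)]
  exact tr_add_of_summable (summable_trTerm_rl (abs_comp_le_of_entryBound hCA hA hW hδ) hδ)
    (summable_trTerm_rl (abs_comp_le_of_entryBound hCB hB hW hδ) hδ)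

/-- [folklore] **THE BUBBLE IS ADDITIVE IN A BOUNDED LEG, WITH THE TWO CROSS WORDS DISPLAYED**:
`bubble (A + B) V W = tr((A∘V)∘(A∘W)) + tr((A∘V)∘(B∘W)) + (tr((B∘V)∘(A∘W)) + tr((B∘V)∘(B∘W)))` for bounded `A`, `B` and vertices bi-localised at `(p,p)`, `(q,q)`. -/
theorem bubble_add_leg_bdd {A B V W : MKer D F} {CA CB Cv Cw δ : ℝ} {p q : Fin D → ℤ} (hA : Bdd A CA) (hB : Bdd B CB)
    (hV : BiLoc V p p Cv δ) (hW : BiLoc W q q Cw δ) (hδ : 0 < δ) :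
    bubble (A + B) V W =
      tr (comp (comp A V) (comp A W)) + tr (comp (comp A V) (comp B W))
        + (tr (comp (comp B V) (comp A W)) + tr (comp (comp B V) (comp B W))) := by
  classical
  rcases isEmpty_or_nonempty F with hF | ⟨⟨a₀⟩⟩
  · simp [ExpKernelCalculus.bubble, ExpKernelCalculus.tr]
  have hCA : 0 ≤ CA := (abs_nonneg _).trans (hA p p a₀ a₀)
  have hCB : 0 ≤ CB := (abs_nonneg _).trans (hB p p a₀ a₀)
  -- right-localised bounds of the four composed kernels
  have hXA := abs_comp_le_of_entryBound hCA hA hV hδ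
  have hXB := abs_comp_le_of_entryBound hCB hB hV hδ
  have hYA := abs_comp_le_of_entryBound hCA hA hW hδ
  have hYB := abs_comp_le_of_entryBound hCB hB hW hδ
  have hYAb := bdd_of_rl hYA hδ.le
  have hYBb := bdd_of_rl hYB hδ.le
  -- distribute the leg sums
  have e1 : comp (A + B) V = comp A V + comp B V := comp_add_left (slices_bdd_biLoc hA hV hδ) (slices_bdd_biLoc hB hV hδ)
  have e2 : comp (A + B) W = comp A W + comp B W := comp_add_left (slices_bdd_biLoc hA hW hδ) (slices_bdd_biLoc hB hW hδ)
  have e3 : comp (comp A V + comp B V) (comp A W + comp B W) =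
      comp (comp A V + comp B V) (comp A W) + comp (comp A V + comp B V) (comp B W) :=
    comp_add_right_of_slices (slices_rl_bdd (rl_add hXA hXB) hYAb hδ) (slices_rl_bdd (rl_add hXA hXB) hYBb hδ)
  have e4 : comp (comp A V + comp B V) (comp A W) = comp (comp A V) (comp A W) + comp (comp B V) (comp A W) :=
    comp_add_left (slices_rl_bdd hXA hYAb hδ) (slices_rl_bdd hXB hYAb hδ)
  have e5 : comp (comp A V + comp B V) (comp B W) = comp (comp A V) (comp B W) + comp (comp B V) (comp B W) :=
    comp_add_left (slices_rl_bdd hXA hYBb hδ) (slices_rl_bdd hXB hYBb hδ)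
  -- summability of the four trace series
  have sAA := summable_trTerm_rl (abs_comp_le_of_rightLoc hXA hYA hδ) hδ
  have sAB := summable_trTerm_rl (abs_comp_le_of_rightLoc hXA hYB hδ) hδ
  have sBA := summable_trTerm_rl (abs_comp_le_of_rightLoc hXB hYA hδ) hδ
  have sBB := summable_trTerm_rl (abs_comp_le_of_rightLoc hXB hYB hδ) hδ
  unfold ExpKernelCalculus.bubble
  rw [e1, e2, e3, e4, e5, tr_add_of_summable (sAA.add sBA |>.congr fun x => by simp [Finset.sum_add_distrib]) (sAB.add sBB |>.congr fun x => by simp [Finset.sum_add_distrib]),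
    tr_add_of_summable sAA sBA, tr_add_of_summable sAB sBB]
  ring

/-! ## §3 The leg split of the fine Hessian table -/

/-- [folklore] **THE LEG SPLIT OF THE FULL FINE HESSIAN TABLE** (`D = 4`): for bounded legs `A`, `B`, first-order stencils bi-localised at their base point
(`BiLoc (S κ u) u u Cs δ`) and bi-tables bi-localised at their two base points,
`fineHessA (A + B) S Wf κ′ l′ u u′ = fineHessA A S Wf κ′ l′ u u′ + ( ½·tadpole B (Wf κ′ u l′ u′) − ½·( tr((A∘S_{κ′u})∘(B∘S_{l′u′})) + tr((B∘S_{κ′u})∘(A∘S_{l′u′})) + bubble B (S κ′ u) (S l′ u′) ) )`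
— the bracket is the sum of the WORDS WITH AT LEAST ONE `B`-LEG (road FP: `A := Pker`, `B := Γ − Pker`, the (G1)∕(G2) pieces). -/
theorem fineHessA_add_leg_bdd {A B : MKer 4 F} {CA CB : ℝ} (hA : Bdd A CA) (hB : Bdd B CB)
    {S : Fin 4 → Site 4 → MKer 4 F} {Cs δ : ℝ} (hS : ∀ κ u, BiLoc (S κ u) u u Cs δ)
    {Wf : Fin 4 → Site 4 → Fin 4 → Site 4 → MKer 4 F} {C2 : ℝ} (hW : ∀ κ u l u', BiLoc (Wf κ u l u') u u' C2 δ) (hδ : 0 < δ)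
    (κ' l' : Fin 4) (u u' : Site 4) :
    fineHessA (A + B) S Wf κ' l' u u' =
      fineHessA A S Wf κ' l' u u'
        + ((1 / 2 : ℝ) * tadpole B (Wf κ' u l' u')
            - (1 / 2 : ℝ) * (tr (comp (comp A (S κ' u)) (comp B (S l' u'))) + tr (comp (comp B (S κ' u)) (comp A (S l' u')))
                + bubble B (S κ' u) (S l' u'))) := by
  rw [fineHessA_apply, fineHessA_apply, tadpoleTableA_apply, tadpoleTableA_apply, bubbleTableA_apply, bubbleTableA_apply,
    tadpole_add_leg_bdd hA hB (hW κ' u l' u') hδ, bubble_add_leg_bdd hA hB (hS κ' u) (hS l' u') hδ]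
  unfold ExpKernelCalculus.bubble
  ring

end Summit.QuantumFields.BalabanUV.Beta.FP.FineHessianLegSplit

end
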